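import Summits.BirchSwinnertonDyer.Rank1Residual.X11b.BDPRouteLocalIndexTorsion
import Summits.BirchSwinnertonDyer.Rank1Residual.X11b.ZpLineIndexTorsion
import HarnessLib

/-!
# X11b, route p2 — the EXACT local index `[G : p^k G + ℤQ] = p^{v(ΨQ)}` for `k ≥ v(ΨQ)` in a group
# `G ⊇ E ≅ ℤ_p` of finite index (e.g. `G = E(ℚ_p)`), and the exponent bound `p^{v(ΨQ)} G ⊆ p^k G + ℤQ`
# (cell `b2b-bsdres`, sub-cell `multr1-p2`, gen 19)

HONEST FRAMING (cell `b2b-bsdres`, verbatim): the goal of the cell is to DELETE the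
COMBINATION-SHAPED residual classes for ALL analytic-rank `≤ 1` curves over `ℚ` — "full BSD
formula for every rank `≤ 1` curve in class `C`" assembled STRICTLY from published theorems — so
that the rank-`≤ 1` remainder becomes exactly the CONSTRUCTION-SHAPED classes, which are TYPED
(missing-input Props), NOT attempted; this is not "finishing BSD". Research route `p2` for class
X11b; nothing booked; X11b stays CONSTRUCTION-SHAPED. Theorems only; no `sorry`; no named fact.

## What is here (step 5 towards the EXACT base Selmer count, JSW17 Prop. 3.2.1 `=`)

Setting of `ZpLineIndex` / `ZpLineIndexTorsion` (gens 15–17): an additive group `G` with a subgroup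
`E ≅ ℤ_p` of finite index (for route p2: `G = E(ℚ_p)`, `E = E⁽²⁾(ℚ_p)`), the coordinate
`Ψ : G →+ ℤ_p` (`psi`; `ker Ψ = G_tors`, `Ψ(G) = p^m ℤ_p`, `p^m = #G[p^∞]`), `Q ∈ G` of infinite
order, `e := v(ΨQ) ≥ m`.  Gen 17 proved `[G : T + p^kG + ℤQ] = p^{min(k, e−m)}` and
`[G : p^kG + ℤQ] ≤ p^{min(k,e−m)} · p^m`.  Here:

* `pow_card_primary_nsmul_mem_range_of_isOfFinAddOrder` — `p^m • t ∈ p^k G` for every torsion `t`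
  (`#G[p^∞] = p^m` is the exact `p`-part of `#G_tors`; the prime-to-`p` torsion is `p`-divisible);
* `mem_range_pow_of_mem_range_pow_card_of_isOfFinAddOrder` — a torsion element of `p^m G` lies in
  `p^k G` for every `k`;
* **`index_range_nsmul_sup_zmultiples_eq_pow_valuation`** — for `k ≥ e`:
  `[G : p^kG + ℤQ] = p^{e}` EXACTLY (the torsion `T ∩ (p^kG + ℤQ)` is the prime-to-`p` torsion, of
  index `p^m` in `T`);
* **`pow_valuation_nsmul_mem_range_sup_zmultiples`** — `p^{e} • P ∈ p^k G + ℤQ` for every `P` and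
  every `k ≥ m`: the quotient `G/(p^kG + ℤQ)` has exponent dividing `p^e`.

These are the two local inputs of the exact count at the two primes above `p`: the coker of
`Sel → E(K_𝔭̄)/p^k` has order exactly `p^e`, and `p^e` kills it.

References: [Castella2018] proof of Thm. 2.3, (3.2.1) and (calcul) (arXiv:1704.06608 pp. 5–6);
[JetchevSkinnerWan2017] (7.1.5); [SilvermanAEC2009] VII.6.3.
-/

noncomputable section

open scoped Classical

namespace Summit.BirchSwinnertonDyer.Rank1Residual.X11b.LocalIndex

variable {p : ℕ} [Fact p.Prime]

section Torsion

variable {G : Type*} [AddCommGroup G] (E : AddSubgroup G) [hE : E.FiniteIndex] (φ : E ≃+ ℤ_[p])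

include E φ in
/-- If `p^m = #G[p^∞]` then `#G_tors = p^m · N'` with `p ∤ N'`: the `p`-primary component is the
exact `p`-part of the (finite) torsion subgroup. [folklore] -/
theorem exists_card_torsion_eq_pow_mul {m : ℕ} (hmcard : p ^ m = Nat.card (AddCommGroup.primaryComponent G p)) :
    ∃ N' : ℕ, ¬ p ∣ N' ∧ Nat.card (AddCommGroup.torsion G) = p ^ m * N' := by
  haveI : Finite (AddCommGroup.torsion G) := finite_torsion E φ
  have hp : p.Prime := Fact.out
  set N := Nat.card (AddCommGroup.torsion G) with hN
  have hN0 : N ≠ 0 := Nat.card_pos.ne'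
  have hfac : N.factorization p = m := by
    have h := Literature.NumberTheory.EllipticCurves.card_addPrimaryComponent_eq_pow
      (A := AddCommGroup.torsion G) p
    rw [natCard_primaryComponent_torsion G p, ← hmcard] at h
    exact (Nat.pow_right_injective hp.two_le h).symm
  refine ⟨N / p ^ m, ?_, ?_⟩
  · rw [← hfac]
    exact Nat.not_dvd_ordCompl hp hN0
  · rw [← hfac]
    exact (Nat.ordProj_mul_ordCompl_eq_self N p).symm

include E φ in
/-- **`p^m • t ∈ p^k G` for every torsion element `t`** (`p^m = #G[p^∞]`): `p^m t` has order dividing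
the prime-to-`p` part of `#G_tors`, and elements of order prime to `p` are `p^k`-th multiples.
[folklore] -/
theorem pow_card_primary_nsmul_mem_range_of_isOfFinAddOrder {m : ℕ}
    (hmcard : p ^ m = Nat.card (AddCommGroup.primaryComponent G p)) {t : G} (ht : IsOfFinAddOrder t)
    (k : ℕ) : p ^ m • t ∈ (nsmulAddMonoidHom (p ^ k) : G →+ G).range := by
  haveI : Finite (AddCommGroup.torsion G) := finite_torsion E φ
  have hp : p.Prime := Fact.out
  obtain ⟨N', hN', hcardT⟩ := exists_card_torsion_eq_pow_mul E φ hmcard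
  -- `#T • t = 0`
  have hT : Nat.card (AddCommGroup.torsion G) • t = 0 := by
    have h : Nat.card (AddCommGroup.torsion G) •
        (⟨t, (AddCommGroup.mem_torsion _).mpr ht⟩ : AddCommGroup.torsion G) = 0 := card_nsmul_eq_zero'
    exact congrArg Subtype.val h
  rw [hcardT, mul_comm, mul_smul] at hT
  -- `p^m • t` has order dividing `N'`, coprime to `p`
  have hfin : IsOfFinAddOrder (p ^ m • t) := ht.nsmul
  have hdvd : addOrderOf (p ^ m • t) ∣ N' := addOrderOf_dvd_of_nsmul_eq_zero hT
  have hcop : (addOrderOf (p ^ m • t)).Coprime p :=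
    Nat.Coprime.coprime_dvd_left hdvd ((Nat.Prime.coprime_iff_not_dvd hp).mpr hN').symm
  exact mem_range_nsmul_pow_of_coprime k hfin hcop

include E φ in
/-- **A torsion element of `p^m G` lies in `p^k G` for every `k`** (`p^m = #G[p^∞]`): if `t = p^m g`
is torsion then `g` is torsion. [folklore] -/
theorem mem_range_pow_of_mem_range_pow_card_of_isOfFinAddOrder {m : ℕ}
    (hmcard : p ^ m = Nat.card (AddCommGroup.primaryComponent G p)) {t : G} (ht : IsOfFinAddOrder t)
    (hmem : t ∈ (nsmulAddMonoidHom (p ^ m) : G →+ G).range) (k : ℕ) :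
    t ∈ (nsmulAddMonoidHom (p ^ k) : G →+ G).range := by
  obtain ⟨g, rfl⟩ := hmem
  rw [nsmulAddMonoidHom_apply] at ht ⊢
  have hg : IsOfFinAddOrder g := by
    obtain ⟨a, ha, hat⟩ := ht.exists_nsmul_eq_zero
    rw [smul_smul] at hat
    exact isOfFinAddOrder_iff_nsmul_eq_zero.mpr
      ⟨a * p ^ m, Nat.mul_pos ha (pow_pos (Fact.out : p.Prime).pos m), hat⟩
  exact pow_card_primary_nsmul_mem_range_of_isOfFinAddOrder E φ hmcard hg k

variable {m : ℕ} (hm : (psi E φ).range = (Ideal.span {(p : ℤ_[p]) ^ m}).toAddSubgroup)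
  (hmcard : p ^ m = Nat.card (AddCommGroup.primaryComponent G p))

include hm in
/-- If `Ψ y ∈ p^{k+m} ℤ_p` then `y ∈ p^k G + G_tors` (`Ψ(G) = p^m ℤ_p`, `ker Ψ = G_tors`). [folklore] -/
theorem mem_range_sup_torsion_of_psi_mem {k : ℕ} {y : G}
    (hy : psi E φ y ∈ (Ideal.span {(p : ℤ_[p]) ^ (k + m)}).toAddSubgroup) :
    y ∈ (nsmulAddMonoidHom (p ^ k) : G →+ G).range ⊔ AddCommGroup.torsion G := by
  obtain ⟨z, hz⟩ := (mem_span_pow_iff (k + m) _).mp hy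
  -- `p^m z = Ψ g`
  have hmem : (p : ℤ_[p]) ^ m * z ∈ (psi E φ).range := by
    rw [hm, mem_span_pow_iff]; exact ⟨z, rfl⟩
  obtain ⟨g, hg⟩ := hmem
  have hker : y - p ^ k • g ∈ (psi E φ).ker := by
    rw [AddMonoidHom.mem_ker, map_sub, map_nsmul, hg, hz, pow_add, nsmul_eq_mul, Nat.cast_pow, mul_assoc,
      sub_self]
  rw [ker_psi] at hker
  have : y = p ^ k • g + (y - p ^ k • g) := by abel
  rw [this]
  exact AddSubgroup.add_mem_sup ⟨g, rfl⟩ hker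

omit hE in
/-- An integer which, read in `ℤ_p`, lies in `p^a ℤ_p` is divisible by `p^a`. [folklore] -/
theorem pow_dvd_of_intCast_mem_span {a : ℕ} {c : ℤ}
    (hc : (c : ℤ_[p]) ∈ (Ideal.span {(p : ℤ_[p]) ^ a}).toAddSubgroup) : ((p ^ a : ℕ) : ℤ) ∣ c := by
  rw [Submodule.mem_toAddSubgroup, ← PadicInt.ker_toZModPow, RingHom.mem_ker, map_intCast] at hc
  exact (ZMod.intCast_zmod_eq_zero_iff_dvd c (p ^ a)).mp hc

omit hE in
/-- A nonzero element of `p^a ℤ_p` has valuation `≥ a`. [folklore] -/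
theorem le_valuation_of_mem_span_pow {a : ℕ} {x : ℤ_[p]} (hx : x ≠ 0)
    (hmem : x ∈ (Ideal.span {(p : ℤ_[p]) ^ a}).toAddSubgroup) : a ≤ x.valuation := by
  obtain ⟨z, hz⟩ := (mem_span_pow_iff a x).mp hmem
  have hz0 : z ≠ 0 := by rintro rfl; rw [mul_zero] at hz; exact hx hz
  rw [hz, PadicInt.valuation_p_pow_mul a z hz0]
  exact Nat.le_add_right a _

include hm in
/-- `m ≤ v(ΨQ)` for `Q` of infinite order (`ΨQ ∈ Ψ(G) = p^m ℤ_p`, nonzero). [folklore] -/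
theorem le_valuation_psi (Q : G) (hQ : ¬ IsOfFinAddOrder Q) : m ≤ (psi E φ Q).valuation := by
  have hx : psi E φ Q ≠ 0 := fun h ↦ hQ ((psi_eq_zero_iff E φ Q).mp h)
  have hmem : psi E φ Q ∈ (psi E φ).range := ⟨Q, rfl⟩
  rw [hm] at hmem
  exact le_valuation_of_mem_span_pow hx hmem

omit hE in
/-- If `p^m • g` has finite order then so does `g`. [folklore] -/
theorem isOfFinAddOrder_of_nsmul_pow {a : ℕ} {g : G} (h : IsOfFinAddOrder (p ^ a • g)) :
    IsOfFinAddOrder g := by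
  obtain ⟨b, hb, hbg⟩ := h.exists_nsmul_eq_zero
  rw [smul_smul] at hbg
  exact isOfFinAddOrder_iff_nsmul_eq_zero.mpr
    ⟨b * p ^ a, Nat.mul_pos hb (pow_pos (Fact.out : p.Prime).pos a), hbg⟩

include hm hmcard in
/-- **`p^{v(ΨQ)} • P ∈ p^k G + ℤQ` for every `P ∈ G` and every `k ≥ m`** (`Q` of infinite order,
`Ψ(G) = p^m ℤ_p`, `p^m = #G[p^∞]`): the quotient `G/(p^kG + ℤQ)` is killed by `p^{v(ΨQ)}`.  Proof:
`ΨP = c·u` with `ΨQ = u p^e`, `c ∈ p^m ℤ_p`; take `c₀ ∈ ℕ`, `c₀ ≡ c (mod p^k)`, so `p^m ∣ c₀`; then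
`Ψ(p^e P − c₀ Q) ∈ p^{k+m} ℤ_p`, so `p^e P − c₀ Q = p^k g + t` with `t` torsion AND in `p^m G`, hence
`t ∈ p^k G`. [cite: Castella2018, proof of Thm. 2.3, (calcul) (arXiv:1704.06608 p. 6)] -/
theorem pow_valuation_nsmul_mem_range_sup_zmultiples (Q : G) (hQ : ¬ IsOfFinAddOrder Q) {k : ℕ}
    (hk : m ≤ k) (P : G) :
    p ^ (psi E φ Q).valuation • P ∈
      (nsmulAddMonoidHom (p ^ k) : G →+ G).range ⊔ AddSubgroup.zmultiples Q := by
  have hp : p.Prime := Fact.out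
  set f := psi E φ with hf
  set eQ := (f Q).valuation with heQ
  have hx : f Q ≠ 0 := fun h ↦ hQ ((psi_eq_zero_iff E φ Q).mp h)
  set u := PadicInt.unitCoeff hx with hu
  have hxu : f Q = (u : ℤ_[p]) * (p : ℤ_[p]) ^ eQ := PadicInt.unitCoeff_spec hx
  have hme : m ≤ eQ := le_valuation_psi E φ hm Q hQ
  -- `c := ΨP · u⁻¹ ∈ p^m ℤ_p`
  set c : ℤ_[p] := f P * ((u⁻¹ : ℤ_[p]ˣ) : ℤ_[p]) with hc
  have hcm : c ∈ (Ideal.span {(p : ℤ_[p]) ^ m}).toAddSubgroup := by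
    have hmem : f P ∈ f.range := ⟨P, rfl⟩
    rw [hm] at hmem
    rw [Submodule.mem_toAddSubgroup] at hmem ⊢
    exact Ideal.mul_mem_right _ _ hmem
  have hfP : f P = c * (u : ℤ_[p]) := by rw [hc, mul_assoc, Units.inv_mul, mul_one]
  -- `c₀ ≡ c (mod p^k)`, a natural number; `p^m ∣ c₀`
  set c₀ : ℕ := PadicInt.appr c k with hc₀
  have hcc₀ : c - c₀ ∈ Ideal.span {(p : ℤ_[p]) ^ k} := PadicInt.appr_spec k c
  obtain ⟨w, hw⟩ := Ideal.mem_span_singleton'.mp hcc₀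
  have hc₀m : ((c₀ : ℤ) : ℤ_[p]) ∈ (Ideal.span {(p : ℤ_[p]) ^ m}).toAddSubgroup := by
    have h1 : (c₀ : ℤ_[p]) = c - (c - c₀) := by ring
    rw [Int.cast_natCast, h1, Submodule.mem_toAddSubgroup]
    exact Ideal.sub_mem _ hcm
      ((Ideal.span_singleton_le_span_singleton.mpr (pow_dvd_pow (p : ℤ_[p]) hk)) hcc₀)
  obtain ⟨c₁, hc₁⟩ := pow_dvd_of_intCast_mem_span hc₀m
  -- `y := p^e P - c₀ Q` has `Ψ y ∈ p^{k+m}`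
  set y : G := p ^ eQ • P - (c₀ : ℤ) • Q with hy
  have hΨy : f y ∈ (Ideal.span {(p : ℤ_[p]) ^ (k + m)}).toAddSubgroup := by
    rw [mem_span_pow_iff]
    refine ⟨w * (u : ℤ_[p]) * (p : ℤ_[p]) ^ (eQ - m), ?_⟩
    have hkm : k + eQ = (k + m) + (eQ - m) := by omega
    have hc₀' : (c₀ : ℤ_[p]) = c - w * (p : ℤ_[p]) ^ k := by rw [hw]; ring
    rw [hy, map_sub, map_nsmul, map_zsmul, hfP, nsmul_eq_mul, zsmul_eq_mul, hxu, Int.cast_natCast,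
      Nat.cast_pow, hc₀']
    have : ((p : ℤ_[p])) ^ eQ * (c * (u : ℤ_[p])) -
        (c - w * (p : ℤ_[p]) ^ k) * ((u : ℤ_[p]) * (p : ℤ_[p]) ^ eQ) =
        w * (u : ℤ_[p]) * (p : ℤ_[p]) ^ (k + eQ) := by rw [pow_add]; ring
    rw [this, hkm, pow_add]
    ring
  -- so `y = p^k g + t`, `t` torsion
  obtain ⟨a, ⟨g, rfl⟩, t, ht, hsum⟩ := AddSubgroup.mem_sup.mp (mem_range_sup_torsion_of_psi_mem E φ hm hΨy)
  rw [nsmulAddMonoidHom_apply] at hsum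
  -- `t ∈ p^m G`
  have htm : t ∈ (nsmulAddMonoidHom (p ^ m) : G →+ G).range := by
    refine ⟨p ^ (eQ - m) • P - c₁ • Q - p ^ (k - m) • g, ?_⟩
    rw [nsmulAddMonoidHom_apply]
    have ht' : t = y - p ^ k • g := by rw [← hsum]; abel
    rw [ht', hy, hc₁, smul_sub, smul_sub, smul_smul, smul_smul, ← pow_add, ← pow_add,
      Nat.add_sub_cancel' hme, Nat.add_sub_cancel' hk, mul_zsmul', natCast_zsmul, smul_comm (p ^ m) c₁ Q]
  have htk : t ∈ (nsmulAddMonoidHom (p ^ k) : G →+ G).range :=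
    mem_range_pow_of_mem_range_pow_card_of_isOfFinAddOrder E φ hmcard
      ((AddCommGroup.mem_torsion _).mp ht) htm k
  obtain ⟨g', hg'⟩ := htk
  rw [nsmulAddMonoidHom_apply] at hg'
  -- conclude: `p^e P = (p^k g + t) + c₀ Q`
  have hP : p ^ eQ • P = p ^ k • (g + g') + (c₀ : ℤ) • Q := by
    rw [smul_add, hg', hsum, hy, sub_add_cancel]
  rw [hP]
  exact AddSubgroup.add_mem_sup ⟨g + g', rfl⟩ (AddSubgroup.zsmul_mem_zmultiples Q (c₀ : ℤ))

include hm hmcard in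
/-- **THE EXACT LOCAL INDEX `[G : p^k G + ℤQ] = p^{v(ΨQ)}` for `k ≥ v(ΨQ)`** (`Q` of infinite order;
`Ψ(G) = p^m ℤ_p`, `p^m = #G[p^∞]`).  `[G : p^kG + ℤQ] = [G : T + p^kG + ℤQ] · [T : T ∩ (p^kG + ℤQ)]
= p^{v(ΨQ) − m} · p^m`: the torsion meeting `p^kG + ℤQ` is exactly the torsion of `p^m G`, i.e. the
prime-to-`p` torsion (of index `#G[p^∞] = p^m` in `T`).  For `G = E(ℚ_p)`, `Q` the image of a
generator of `E(K)/tors`: `[E(ℚ_p) : p^k E(ℚ_p) + ℤQ] = p^e`,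
`e = (ord_p log_ω Q − 1) + ord_p c_p` = JSW17's `#δ_v` — with NO hypothesis on `E(ℚ_p)[p]`.
[cite: JetchevSkinnerWan2017, Prop. 3.2.1 and (7.1.5) (arXiv:1512.06894 pp. 10–11, 16)]
[cite: Castella2018, proof of Thm. 2.3, (3.2.1) and (calcul) (arXiv:1704.06608 pp. 5–6)] -/
theorem index_range_nsmul_sup_zmultiples_eq_pow_valuation (Q : G) (hQ : ¬ IsOfFinAddOrder Q) {k : ℕ}
    (hk : (psi E φ Q).valuation ≤ k) :
    ((nsmulAddMonoidHom (p ^ k) : G →+ G).range ⊔ AddSubgroup.zmultiples Q).index =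
      p ^ (psi E φ Q).valuation := by
  classical
  have hp : p.Prime := Fact.out
  haveI : Finite (AddCommGroup.torsion G) := finite_torsion E φ
  haveI : Finite (AddCommGroup.primaryComponent G p) := finite_primaryComponent E φ
  set f := psi E φ with hf
  set eQ := (f Q).valuation with heQ
  set T : AddSubgroup G := AddCommGroup.torsion G with hT
  set H := (nsmulAddMonoidHom (p ^ k) : G →+ G).range ⊔ AddSubgroup.zmultiples Q with hH
  have hx : f Q ≠ 0 := fun h ↦ hQ ((psi_eq_zero_iff E φ Q).mp h)
  have hme : m ≤ eQ := le_valuation_psi E φ hm Q hQ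
  have hmk : m ≤ k := hme.trans hk
  -- `[G : H] = [T ⊔ H : H]·[G : T ⊔ H]`
  have h1 : H.relIndex (T ⊔ H) * (T ⊔ H).index = H.index := AddSubgroup.relIndex_mul_index le_sup_right
  have h2 : H.relIndex (T ⊔ H) = H.relIndex T := AddSubgroup.relIndex_sup_right _ _
  have h3 : (T ⊔ H).index = p ^ (eQ - m) := by
    rw [hT, hH, index_torsion_sup_range_nsmul_sup_zmultiples E φ hm Q hQ k,
      min_eq_right ((Nat.sub_le _ _).trans hk)]
  -- `[T : T ⊓ H] = p^m`
  have hle : H.relIndex T ≤ p ^ m := by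
    rw [hmcard]; exact relIndex_torsion_le_natCard_primaryComponent E φ k le_sup_left
  -- multiplication by `p^m` on `T`
  let ψ : T →+ T := (nsmulAddMonoidHom (p ^ m) : T →+ T)
  -- `H ⊓ T ≤ p^m T`
  have hA : H.addSubgroupOf T ≤ ψ.range := by
    rintro ⟨t, htT⟩ htH
    rw [AddSubgroup.mem_addSubgroupOf] at htH
    change t ∈ H at htH
    obtain ⟨a, ⟨g, rfl⟩, b, hb, hsum⟩ := AddSubgroup.mem_sup.mp htH
    obtain ⟨c, rfl⟩ := AddSubgroup.mem_zmultiples_iff.mp hb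
    rw [nsmulAddMonoidHom_apply] at hsum
    -- `Ψ t = 0`: `(-c : ℤ_p) · ΨQ = p^k Ψ g`
    have hft : f t = 0 := (psi_eq_zero_iff E φ t).mpr ((AddCommGroup.mem_torsion _).mp htT)
    have hrel : (((-c : ℤ)) : ℤ_[p]) * f Q = (p : ℤ_[p]) ^ k * f g := by
      have h := hft
      rw [← hsum, map_add, map_nsmul, map_zsmul, nsmul_eq_mul, zsmul_eq_mul, Nat.cast_pow] at h
      rw [Int.cast_neg]
      linear_combination -h
    -- `p^m ∣ c`
    have hcm : ((c : ℤ) : ℤ_[p]) ∈ (Ideal.span {(p : ℤ_[p]) ^ m}).toAddSubgroup := by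
      have hneg : ((-c : ℤ) : ℤ_[p]) ∈ (Ideal.span {(p : ℤ_[p]) ^ m}).toAddSubgroup := by
        by_cases hc0 : ((-c : ℤ) : ℤ_[p]) = 0
        · rw [hc0]; exact AddSubgroup.zero_mem _
        · have hfg : f g ≠ 0 := by
            intro h0
            rw [h0, mul_zero] at hrel
            exact hc0 ((mul_eq_zero.mp hrel).resolve_right hx)
          have hvg : m ≤ (f g).valuation := by
            have hmem : f g ∈ f.range := ⟨g, rfl⟩
            rw [hm] at hmem
            exact le_valuation_of_mem_span_pow hfg hmem
          have hv1 : ((((-c : ℤ)) : ℤ_[p]) * f Q).valuation = (((-c : ℤ)) : ℤ_[p]).valuation + eQ :=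
            PadicInt.valuation_mul hc0 hx
          have hv2 : ((((-c : ℤ)) : ℤ_[p]) * f Q).valuation = k + (f g).valuation := by
            rw [hrel, PadicInt.valuation_p_pow_mul k (f g) hfg]
          have hvc : m ≤ (((-c : ℤ)) : ℤ_[p]).valuation := by omega
          exact mem_span_pow_of_le_valuation hc0 hvc
      have h2 : ((c : ℤ) : ℤ_[p]) = -(((-c : ℤ)) : ℤ_[p]) := by push_cast; ring
      rw [h2]
      exact AddSubgroup.neg_mem _ hneg
    obtain ⟨c₁, hc₁⟩ := pow_dvd_of_intCast_mem_span hcm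
    -- `t = p^m • g''`
    set g'' : G := p ^ (k - m) • g + c₁ • Q with hg''
    have htg : t = p ^ m • g'' := by
      rw [hg'', smul_add, smul_smul, ← pow_add, Nat.add_sub_cancel' hmk, ← hsum, hc₁, mul_zsmul',
        natCast_zsmul, smul_comm (p ^ m) c₁ Q]
    have hg''T : g'' ∈ T :=
      (AddCommGroup.mem_torsion _).mpr (isOfFinAddOrder_of_nsmul_pow
        (htg ▸ (AddCommGroup.mem_torsion _).mp htT))
    refine ⟨⟨g'', hg''T⟩, Subtype.ext ?_⟩
    change p ^ m • g'' = t
    exact htg.symm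
  -- `[T : p^m T] ≥ p^m`
  have hB : p ^ m ≤ ψ.range.index := by
    rw [AddSubgroup.index_eq_card, TamagawaCoinvariants.natCard_quotient_range_eq_natCard_ker ψ, hmcard]
    refine Nat.card_le_card_of_injective (fun x ↦ ⟨⟨(x : G), ?_⟩, ?_⟩) ?_
    · obtain ⟨j, hj⟩ := (AddCommGroup.mem_primaryComponent).mp x.2
      exact (AddCommGroup.mem_torsion _).mpr (isOfFinAddOrder_iff_nsmul_eq_zero.mpr
        ⟨p ^ j, pow_pos hp.pos j, hj⟩)
    · rw [AddMonoidHom.mem_ker]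
      apply Subtype.ext
      change p ^ m • (x : G) = 0
      have h : Nat.card (AddCommGroup.primaryComponent G p) • x = 0 := card_nsmul_eq_zero'
      rw [← hmcard] at h
      exact congrArg Subtype.val h
    · intro a b hab
      exact Subtype.ext (congrArg (fun z : ψ.ker ↦ ((z : T) : G)) hab)
  have hge : p ^ m ≤ H.relIndex T := by
    have hdvd : ψ.range.index ∣ (H.addSubgroupOf T).index := AddSubgroup.index_dvd_of_le hA
    have hne : (H.addSubgroupOf T).index ≠ 0 := AddSubgroup.FiniteIndex.index_ne_zero
    exact hB.trans (Nat.le_of_dvd (Nat.pos_of_ne_zero hne) hdvd)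
  have h4 : H.relIndex T = p ^ m := le_antisymm hle hge
  rw [← h1, h2, h4, h3, ← pow_add, Nat.add_sub_cancel' hme]

end Torsion

end Summit.BirchSwinnertonDyer.Rank1Residual.X11b.LocalIndex

end
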